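import Summits.HodgeConjecture.CorCM.HypDel.ExtAmbientReceptacleQArchB
import HarnessLib
/-!
# τ0-T3 v4 (C) — the frame statement RE-CUT: `FrameExists'` (v5) and the head `ambientReceptacle_of'` re-pointed to it

Cell `hodgecm-mathlib`, crux `HDel` (stmt-HodgeConjecture-24835), fan B / B-plan2 (T3 pen), ruling T3-v5 (B-plan2 g5, 2026-08-28T15:36Z)
on B-p03's DESIGN FLAG (2026-08-28T15:32Z).  The v4 statement `QArch.FrameExists` (★ `…QArchA`) is FALSE as typed — (W1) its level tail
quantifies over `N = 0` (`N₁ ∣ 0`), where `auxLevel F 0 = ⊥` cannot be an open product level; (W2) with `(T) (hT)` inside the `∃` there is no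
hermitian hypothesis on `H` when `hpos` is vacuous (`L⁺ = ℚ`), and then `SymplecticFrame M j H ξ₀ ξ g δ` may be empty.  v5 (minimal re-cut,
same binder order as `S2Inj` / `S2Pair` / `S2Imm` / `SQuot` / `S4Push`): the binders `(T : GL (Fin 3) ℂ) (hT : formCongr … = BallModel.J)` move
OUTSIDE the `∃`, the `C0pm` clause loses its `∀ T`, and the tail reads `∀ N, N₁ ∣ N → 0 < N → …`.  This module (mechanics (m1): ONE new module,
★ `…QArchA` / `…QArchB` untouched, append-only respected) carries `FrameExists'` and the HEAD `ambientReceptacle_of'` = ★ `ambientReceptacle_of`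
with exactly three edits (the frame is opened with `T hT`; the tower and the working level pass `0 < N`).  The workfile v4.2 registers
`stub_frame : QArch.FrameExists'` and concludes through `QArch.ambientReceptacle_of'`.  NOTHING IS ASSERTED (one `Prop`, one kernel-checked head;
0 `sorry`).  HC_CM is proved only modulo the 7 printed citations until rung 0 closes; nothing in this file is a proof of I-1′ or of `HDel`.
[cite: Deligne1971TravauxShimura, §5, Thm 4.21, 1.15, 5.4] [cite: Deligne1979ShimuraVarieties, Prop. 2.3.10] [cite: Milne2005ShimuraVarieties, §14 Prop 14.12, §12 (62)]
-/

noncomputable section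

open Function MulAction Topology NumberField IsDedekindDomain CategoryTheory CategoryTheory.Limits Matrix
  AlgebraicGeometry
open scoped Matrix ComplexOrder
open Literature.AlgebraicGeometry Literature.AlgebraicGeometry.Motives
open Literature.NumberTheory.Automorphic Literature.NumberTheory.Automorphic.UnitaryGroup
open Literature.NumberTheory.Automorphic.Liu2021.AppendixC (C5.OpenCompactSubgroup C5.SmallLevel)
open Literature.Geometry.ComplexHyperbolic Literature.Geometry.ComplexHyperbolic.BallModel
open Literature.AlgebraicGeometry.ShimuraVarieties Literature.AlgebraicGeometry.ShimuraVarieties.UnitaryCanonicalModel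
open Literature.AlgebraicGeometry.ShimuraVarieties.UnitaryCanonicalModel.Aux
open Literature.AlgebraicGeometry.ModuliOfAbelianVarieties
open Literature.NumberTheory.ComplexMultiplication (traceField reflexNormFiniteIdele)
open Literature.NumberTheory.AdelicBaseChange (finiteIdeleRelNorm)
open Summit.HodgeConjecture.CorCM.HypDel.ExtReceptacle (ReciprocityThrough AmbientReceptacle AmbientReceptacleExists)

namespace Summit.HodgeConjecture.CorCM.HypDel.ExtReceptacle.QArch

/-- **FRAME, v5 (owner B-p03; Q6a+Q6b+ξ-choice): `(T) (hT)` binders outside the `∃`, `0 < N →` in the level tail.**  Supersedes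
`FrameExists` (v4), which is false: N = 0 tail (W1) / no hermitian hypothesis when `hpos` is vacuous (W2), B-p03 2026-08-28. -/
def FrameExists' : Prop :=
  ∀ (L : Type) [Field L] [NumberField L] [IsCMField L] (H : Matrix (Fin 3) (Fin 3) L) (τ : L →+* ℂ)
    (T : GL (Fin 3) ℂ) (hT : formCongr (starRingEnd ℂ) T (H.map τ) = BallModel.J),
    (∀ τ' : L →+* ℂ, InfinitePlace.mk τ' ≠ InfinitePlace.mk τ → (H.map τ').PosDef) →
    (∀ v : Fin 3 → L, ShimuraVarieties.hermForm (cmConjRingHom L) H v v = 0 → v = 0) →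
    ∀ K₀ : C5.OpenCompactSubgroup ↥(finAdelic (↥(maximalRealSubfield L)) L (IsCMField.complexConj L) 3 H),
        ∀ (M : Type) [Field M] [NumberField M] [IsCMField M] (j : L →+* M) (Φ : CMType M), IsExtAdapted τ j Φ →
            ∀ (L₀ : C5.OpenCompactSubgroup ↥(torusFinAdelic M)) (K : C5.SmallLevel K₀),
              ∃ (ξ₀ ξ : M) (g : ℕ) (δ : Fin g → ℕ) (F : SymplecticFrame M j H ξ₀ ξ g δ) (N₁ : ℕ),
                IsAuxScalars M Φ ξ₀ ξ ∧ 0 < g ∧ IsPolarizationType δ ∧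
                  (∀ x : Ball, auxComplexStructure F τ Φ T x ∈ C0pm δ) ∧ 0 < N₁ ∧ K.1.1.prod L₀.1 ≤ auxLevel F 1 ∧
                  ∀ N : ℕ, N₁ ∣ N → 0 < N →
                    auxLevel F N ≤ K.1.1.prod L₀.1 ∧
                      (∀ x ∈ K.1.1.prod L₀.1, ∀ y ∈ auxLevel F N, x⁻¹ * y * x ∈ auxLevel F N) ∧
                        ∃ (KV : C5.SmallLevel K₀) (LV : C5.OpenCompactSubgroup ↥(torusFinAdelic M)),
                          KV ≤ K ∧ LV ≤ L₀ ∧ IsProductLevel M F N KV.1.1 LV.1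

/-- **HEAD of §8 on the v5 frame (kernel-checked, no `sorry` of its own): `AmbientReceptacleExists` from the seven statements, the frame read
as `FrameExists'`.**  Supersedes `ambientReceptacle_of` (v4 frame). -/
theorem ambientReceptacle_of' (h1 : SiegelS1) (hF : FrameExists') (h2i : S2Inj) (h2p : S2Pair) (h2c : S2Imm) (hQ : SQuot)
    (h4 : S4Push) : AmbientReceptacleExists := by
  intro L _ _ _ H τ T hT hpos hanis K₀ htf Sc M _ _ _ j Φ hΦ E _ hE hΦE L₀ K
  -- frame + scalars
  obtain ⟨ξ₀, ξ, g, δ, F, N₁, hsc, hg, hδ, hJ, hN₁, hle1, hlev⟩ := hF L H τ T hT hpos hanis K₀ M j Φ hΦ L₀ K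
  -- Siegel canonical model
  obtain ⟨Sg, R, hcan, hhecke⟩ := h1 g δ hg hδ
  -- the injectivity tower over N' = 3 · N₁ : product levels from the frame, morphisms from S2pair at every level
  set N' : ℕ := 3 * N₁ with hN'def
  have hN' : 3 ≤ N' := by
    calc 3 = 3 * 1 := by norm_num
      _ ≤ 3 * N₁ := Nat.mul_le_mul_left 3 hN₁
      _ = N' := by rw [hN'def]
  have htower : ∀ m : ℕ, ∃ (KV : C5.SmallLevel K₀) (LV : C5.OpenCompactSubgroup ↥(torusFinAdelic M)),
      KV ≤ K ∧ LV ≤ L₀ ∧ IsProductLevel M F (N' * (m + 1)) KV.1.1 LV.1 :=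
    fun m => (hlev (N' * (m + 1)) ⟨3 * (m + 1), by rw [hN'def]; ring⟩ (Nat.mul_pos (by omega) m.succ_pos)).2.2
  choose KV LV hKV hLV hprod using htower
  have hιex : ∀ m : ℕ, ∃ ι' : (complexSystemExt M Sc (LV m)).obj (KV m) ⟶
      Sg.Mc.obj (SiegelLevel.ofNat δ (N' * (m + 1)) (three_le_mul_succ hN' m)),
      PointFormulaN M Sc Φ F hJ (LV m) (KV m) Sg (SiegelLevel.ofNat δ (N' * (m + 1)) (three_le_mul_succ hN' m)) ι' :=
    fun m => h2p L H τ T hT hpos hanis K₀ htf Sc M j Φ hΦ ξ₀ ξ g δ F hsc hg hδ hJ Sg (N' * (m + 1)) (three_le_mul_succ hN' m)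
      (KV m) (LV m) (hprod m)
  choose ι hpfι using hιex
  -- injectivity at some tower level m₀; the working level N = N' · (m₀ + 1)
  obtain ⟨m₀, hpi⟩ := h2i L H τ T hT hpos hanis K₀ htf Sc M j Φ hΦ ξ₀ ξ g δ F hsc hg hδ hJ Sg N' hN' KV LV hprod ι hpfι
  set N : ℕ := N' * (m₀ + 1) with hNdef
  have hN3 : 3 ≤ N := three_le_mul_succ hN' m₀
  have hN₁N : N₁ ∣ N := ⟨3 * (m₀ + 1), by rw [hNdef, hN'def]; ring⟩
  obtain ⟨hle, hnorm, -⟩ := hlev N hN₁N (lt_of_lt_of_le (by norm_num) hN3)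
  -- S2 at the working level
  have hpf : PointFormulaN M Sc Φ F hJ (LV m₀) (KV m₀) Sg (SiegelLevel.ofNat δ N hN3) (ι m₀) := hpfι m₀
  have himm' : IsClosedImmersion (ι m₀).left :=
    h2c L H τ T hT hpos hanis K₀ htf Sc M j Φ hΦ ξ₀ ξ g δ F hsc hg hδ hJ Sg N hN3 (KV m₀) (LV m₀) (hprod m₀) (ι m₀) hpf hpi
  -- quotient receptacle over E
  obtain ⟨A, ι, Ψ, himm, hpfK, hgal⟩ :=
    hQ L H τ T hT hpos hanis K₀ htf Sc M j Φ hΦ E hE hΦE L₀ K ξ₀ ξ g δ F hsc hg hδ hJ hle1 Sg R hhecke N hN3 (KV m₀) (LV m₀)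
      (hKV m₀) (hLV m₀) (hprod m₀) hle hnorm (ι m₀) himm' hpf
  -- reciprocity pushed down
  have hrec : ReciprocityThrough M Φ E hE L₀ Sc K A ι :=
    h4 L H τ T hT hpos hanis K₀ htf Sc M j Φ hΦ E hE hΦE L₀ K ξ₀ ξ g δ F hsc hg hδ hJ hle1 Sg R hcan (SiegelLevel.ofNat δ N hN3) A ι Ψ
      hpfK hgal
  exact ⟨⟨A, ι, himm, hrec⟩⟩

end Summit.HodgeConjecture.CorCM.HypDel.ExtReceptacle.QArch

end
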